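import Summits.QuantumFields.BalabanUV.Beta.D1BFx.PeriodicArrays
import Literature.MathematicalPhysics.QuantumFieldTheory.Balaban1983to89.Beta.OneStepKernelFamily

/-!
# `BalabanUV.Beta.D1BFx.PackedStructuralSockets` — road «BF-x» for binder row D1, slot (K), chain step (I) «(A1)-PACKED», brick «SOCKET-PASS»
# (`A1-PACKED-SPEC.md` §8, the STRUCTURAL SOCKETS of the literal's stencils): **ENTRY RELATIONS OF THE STENCILS PASS THROUGH WEIGHTED
# SUPERPOSITIONS, FINITE SUMS AND PERIODIC ARRAYS** — so the packed tables `arr s (vertexOfK K n S μ y)` and `arr s 𝒲^{(s)}` inherit «no mm block»,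
# «fm = ± kernel-transpose of mf» and «ff kernel (anti)symmetry» from the single-bond stencils (the hypotheses of `SortedKKTShape`).

HONEST DEPENDENCY (cell records, verbatim): «continuum YM on T⁴ ⇐ BetaPertH ∧ nine spine estimates (0/9 proved); BetaPertH ⇐ (D1) ∧ (D4) ∧
CAP+tail; G-an2-4 gates asym, D1 and NE2/3/4.»  HONEST FRAMING (cell contract, verbatim): «discharging `BetaPertH` makes Bałaban's UV stability
UNCONDITIONAL — a real constructive-QFT result; it is NOT the continuum limit and NOT the Clay problem.»  THIS MODULE DISCHARGES NOTHING of (K),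
of D1 or of the wall: [folklore] `tsum`∕`Finset.sum` congruences over `OneStepResolventKernel.wsum`, `OneStepKernelFamily.vertexOfK` and
`PeriodicArrays.arr`.  No definition, no `def … : Prop`, nothing cited, 0 sorry.  NOT D1, NOT `BetaPertH`, NOT continuum, NOT Clay.

ABSOLUTE RULE (cell charter, verbatim): «No internally-minted statement may enter as a cited fact. Every hypothesis is either kernel-proved in this
package or a verbatim quotation of a PUBLISHED theorem with page reference. The manuscript(s) under audit are NOT citable for their own disputed
steps — they are the thing under adjudication; programme-internal (2001/route/tribunal) claims are never citable.»

CONTENT (all [folklore]).  An ENTRY RELATION is `V x y a b = ε·V y x b′ a′` (fixed fibre legs `a b a′ b′`, sign∕scalar `ε`) or `V x y a b = 0`.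
* §1 `wsum_entry_zero`, `wsum_entry_rel` (generic `D`, `F`; any weight — the one-periodised family `u ↦ Σ'_{u″} ω u″·K₂ u u″` IS `wsum ω (K₂ u)`).
* §2 `finset_sum_entry_zero`, `finset_sum_entry_rel`; `vertexOfK_entry_zero`, `vertexOfK_entry_rel` (the road's packed first jet).
* §3 `arr_entry_zero`, `arr_entry_rel` (the array swaps the two points together with their images).
* §4 ASSEMBLED for `SortedKKTShape`: `arr_vertexOfK_inr_inr` (no mm block), `arr_vertexOfK_inl_inr` (fm = `ε`·transposed mf), `arr_vertexOfK_inl_inl`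
  (ff `ε`-symmetry) from the corresponding sockets of the stencil family `S`; `arr_wsum_wsum_inr_inr` ∕ `_inl_inr` ∕ `_inl_inl` for a double superposition
  `wsum w (u ↦ wsum (ω u) (K₂ u))` (one slice); **`arr_packed₂_inr_inr` ∕ `_inl_inr` ∕ `_inl_inl`** for the SLICE-SUMMED double superposition
  `Σ_{κ′} Σ_{κ″} wsum (w κ′) (u ↦ wsum (ω κ″) (S₂ κ′ u κ″))` (the road's packed second table `𝒲^{(s)}`).
Unit `b2b-balaban-beta-d1-p2` (road owner, gen 17), 2026-08-22.
-/

noncomputable section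

namespace Summit.QuantumFields.BalabanUV.Beta.D1BFx.PackedStructuralSockets

open scoped BigOperators
open Literature.MathematicalPhysics.QuantumFieldTheory.Balaban1983to89
open Literature.MathematicalPhysics.QuantumFieldTheory.Balaban1983to89.Beta
open ExpKernelCalculus (MKer)
open OneStepResolventKernel (Fib wsum)
open OneStepKernelFamily (vertexOfK colH)
open Summit.QuantumFields.BalabanUV.Beta.D1BFx.PeriodicArrays (arr arr_apply)

variable {D : ℕ} {F : Type*}

/-! ## §1 Weighted superpositions -/

section WSum

variable (w : (Fin D → ℤ) → ℝ) {K : (Fin D → ℤ) → MKer D F}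

/-- [folklore] A vanishing entry of every stencil vanishes in the superposition. -/
theorem wsum_entry_zero {x y : Fin D → ℤ} {a b : F} (h : ∀ u, K u x y a b = 0) : wsum w K x y a b = 0 := by
  simp only [wsum, h, mul_zero, tsum_zero]

/-- [folklore] An entry relation `K u x y a b = ε·K u y x b′ a′` of every stencil holds for the superposition. -/
theorem wsum_entry_rel {ε : ℝ} {x y : Fin D → ℤ} {a b a' b' : F} (h : ∀ u, K u x y a b = ε * K u y x b' a') :
    wsum w K x y a b = ε * wsum w K y x b' a' := by
  simp only [wsum, h, ← tsum_mul_left]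
  exact tsum_congr fun u => by ring

end WSum

/-! ## §2 Finite sums; the road's packed first jet -/

section Sums

/-- [folklore] Finite sums of kernels: vanishing entries. -/
theorem finset_sum_entry_zero {ι : Type*} (T : Finset ι) {K : ι → MKer D F} {x y : Fin D → ℤ} {a b : F} (h : ∀ i ∈ T, K i x y a b = 0) :
    (∑ i ∈ T, K i x y a b) = 0 :=
  Finset.sum_eq_zero h

/-- [folklore] Finite sums of kernels: entry relations. -/
theorem finset_sum_entry_rel {ι : Type*} (T : Finset ι) {K : ι → MKer D F} {ε : ℝ} {x y : Fin D → ℤ} {a b a' b' : F}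
    (h : ∀ i ∈ T, K i x y a b = ε * K i y x b' a') : (∑ i ∈ T, K i x y a b) = ε * ∑ i ∈ T, K i y x b' a' := by
  rw [Finset.mul_sum]
  exact Finset.sum_congr rfl h

variable {d : ℕ} (K : MKer (d + 1) (Fib d)) (n : ℕ) {S : Fin (d + 1) → (Fin (d + 1) → ℤ) → MKer (d + 1) (Fib d)} (μ : Fin (d + 1))
  (y : Fin (d + 1) → ℤ)

/-- [folklore] `vertexOfK`: a vanishing entry of every stencil `S κ′ u` vanishes in the packed first jet. -/
theorem vertexOfK_entry_zero {x z : Fin (d + 1) → ℤ} {a b : Fib d} (h : ∀ κ' u, S κ' u x z a b = 0) : vertexOfK K n S μ y x z a b = 0 :=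
  Finset.sum_eq_zero fun κ' _ => wsum_entry_zero _ (h κ')

/-- [folklore] `vertexOfK`: an entry relation of every stencil holds for the packed first jet. -/
theorem vertexOfK_entry_rel {ε : ℝ} {x z : Fin (d + 1) → ℤ} {a b a' b' : Fib d} (h : ∀ κ' u, S κ' u x z a b = ε * S κ' u z x b' a') :
    vertexOfK K n S μ y x z a b = ε * vertexOfK K n S μ y z x b' a' := by
  unfold vertexOfK
  rw [Finset.mul_sum]
  exact Finset.sum_congr rfl fun κ' _ => wsum_entry_rel _ (h κ')

end Sums

/-! ## §3 Periodic arrays -/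

section Arr

variable (s : ℕ) {V : MKer D F}

/-- [folklore] `arr`: an entry vanishing at all point pairs vanishes in the array. -/
theorem arr_entry_zero {a b : F} (h : ∀ x y, V x y a b = 0) (x y : Fin D → ℤ) : arr s V x y a b = 0 := by
  simp only [arr_apply, h, tsum_zero]

/-- [folklore] `arr`: an entry relation valid at all point pairs holds for the array (both points shift by the same image). -/
theorem arr_entry_rel {ε : ℝ} {a b a' b' : F} (h : ∀ x y, V x y a b = ε * V y x b' a') (x y : Fin D → ℤ) :
    arr s V x y a b = ε * arr s V y x b' a' := by
  simp only [arr_apply, h, ← tsum_mul_left]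

end Arr

/-! ## §4 Assembled: the sockets of `SortedKKTShape` for the packed tables -/

section Assembled

variable {d : ℕ} (K : MKer (d + 1) (Fib d)) (n s : ℕ) {S : Fin (d + 1) → (Fin (d + 1) → ℤ) → MKer (d + 1) (Fib d)} (μ : Fin (d + 1))
  (y : Fin (d + 1) → ℤ)

/-- [folklore] **NO mm BLOCK** passes to `arr s (vertexOfK K n S μ y)`. -/
theorem arr_vertexOfK_inr_inr (hmm : ∀ κ' u x z (a b : Fin (d + 1)), S κ' u x z (Sum.inr a) (Sum.inr b) = 0)
    (x z : Fin (d + 1) → ℤ) (a b : Fin (d + 1)) : arr s (vertexOfK K n S μ y) x z (Sum.inr a) (Sum.inr b) = 0 :=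
  arr_entry_zero s (fun x z => vertexOfK_entry_zero K n μ y (fun κ' u => hmm κ' u x z a b)) x z

/-- [folklore] **fm = `ε`·TRANSPOSED mf** passes to `arr s (vertexOfK K n S μ y)` (`ε = 1`: `SortedKKTShape.blocksHat_sortK_eq_kkt`; `ε = −1`: `…_mul_sgn`). -/
theorem arr_vertexOfK_inl_inr {ε : ℝ} (hfm : ∀ κ' u x z (a b : Fin (d + 1)), S κ' u x z (Sum.inl a) (Sum.inr b) = ε * S κ' u z x (Sum.inr b) (Sum.inl a))
    (x z : Fin (d + 1) → ℤ) (a b : Fin (d + 1)) :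
    arr s (vertexOfK K n S μ y) x z (Sum.inl a) (Sum.inr b) = ε * arr s (vertexOfK K n S μ y) z x (Sum.inr b) (Sum.inl a) :=
  arr_entry_rel s (fun x z => vertexOfK_entry_rel K n μ y (fun κ' u => hfm κ' u x z a b)) x z

/-- [folklore] **ff `ε`-SYMMETRY** passes to `arr s (vertexOfK K n S μ y)` (`ε = −1`: `SortedKKTShape.transpose_ffHat_eq_neg`; `ε = 1`: `transpose_ffHat_eq`). -/
theorem arr_vertexOfK_inl_inl {ε : ℝ} (hff : ∀ κ' u x z (a b : Fin (d + 1)), S κ' u x z (Sum.inl a) (Sum.inl b) = ε * S κ' u z x (Sum.inl b) (Sum.inl a))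
    (x z : Fin (d + 1) → ℤ) (a b : Fin (d + 1)) :
    arr s (vertexOfK K n S μ y) x z (Sum.inl a) (Sum.inl b) = ε * arr s (vertexOfK K n S μ y) z x (Sum.inl b) (Sum.inl a) :=
  arr_entry_rel s (fun x z => vertexOfK_entry_rel K n μ y (fun κ' u => hff κ' u x z a b)) x z

variable {w : (Fin (d + 1) → ℤ) → ℝ} {ω : (Fin (d + 1) → ℤ) → (Fin (d + 1) → ℤ) → ℝ}
  {K₂ : (Fin (d + 1) → ℤ) → (Fin (d + 1) → ℤ) → MKer (d + 1) (Fib d)}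

/-- [folklore] **NO mm BLOCK** passes to the array of a double superposition `arr s (wsum w (u ↦ wsum (ω u) (K₂ u)))` (the one-periodised second table of
F-g16-1, slice by slice, has `ω u := Σ'_m w′ (· + s·m)`). -/
theorem arr_wsum_wsum_inr_inr (hmm : ∀ u u' x z (a b : Fin (d + 1)), K₂ u u' x z (Sum.inr a) (Sum.inr b) = 0)
    (x z : Fin (d + 1) → ℤ) (a b : Fin (d + 1)) : arr s (wsum w (fun u => wsum (ω u) (K₂ u))) x z (Sum.inr a) (Sum.inr b) = 0 :=
  arr_entry_zero s (fun x z => wsum_entry_zero _ fun u => wsum_entry_zero _ fun u' => hmm u u' x z a b) x z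

/-- [folklore] **fm = `ε`·TRANSPOSED mf** passes to the array of a double superposition. -/
theorem arr_wsum_wsum_inl_inr {ε : ℝ} (hfm : ∀ u u' x z (a b : Fin (d + 1)), K₂ u u' x z (Sum.inl a) (Sum.inr b) = ε * K₂ u u' z x (Sum.inr b) (Sum.inl a))
    (x z : Fin (d + 1) → ℤ) (a b : Fin (d + 1)) :
    arr s (wsum w (fun u => wsum (ω u) (K₂ u))) x z (Sum.inl a) (Sum.inr b)
      = ε * arr s (wsum w (fun u => wsum (ω u) (K₂ u))) z x (Sum.inr b) (Sum.inl a) :=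
  arr_entry_rel s (fun x z => wsum_entry_rel _ fun u => wsum_entry_rel _ fun u' => hfm u u' x z a b) x z

/-- [folklore] **ff `ε`-SYMMETRY** passes to the array of a double superposition. -/
theorem arr_wsum_wsum_inl_inl {ε : ℝ} (hff : ∀ u u' x z (a b : Fin (d + 1)), K₂ u u' x z (Sum.inl a) (Sum.inl b) = ε * K₂ u u' z x (Sum.inl b) (Sum.inl a))
    (x z : Fin (d + 1) → ℤ) (a b : Fin (d + 1)) :
    arr s (wsum w (fun u => wsum (ω u) (K₂ u))) x z (Sum.inl a) (Sum.inl b)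
      = ε * arr s (wsum w (fun u => wsum (ω u) (K₂ u))) z x (Sum.inl b) (Sum.inl a) :=
  arr_entry_rel s (fun x z => wsum_entry_rel _ fun u => wsum_entry_rel _ fun u' => hff u u' x z a b) x z

variable {wd ωd : Fin (d + 1) → (Fin (d + 1) → ℤ) → ℝ}
  {S₂ : Fin (d + 1) → (Fin (d + 1) → ℤ) → Fin (d + 1) → (Fin (d + 1) → ℤ) → MKer (d + 1) (Fib d)}

/-- [folklore] **NO mm BLOCK** passes to the array of the SLICE-SUMMED double superposition
`arr s (fun x y a b => Σ_{κ′} Σ_{κ″} wsum (w κ′) (u ↦ wsum (ω κ″) (S₂ κ′ u κ″)) x y a b)` — the road's packed second table `𝒲^{(s)}` of F-g16-1 (there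
`ω κ″ := Σ'_m colH G₀ n ν ŷ κ″ (· + s·m)`), from the socket on every pair stencil `S₂ κ′ u κ″ u′`. -/
theorem arr_packed₂_inr_inr (hmm : ∀ κ u κ' u' x z (a b : Fin (d + 1)), S₂ κ u κ' u' x z (Sum.inr a) (Sum.inr b) = 0)
    (x z : Fin (d + 1) → ℤ) (a b : Fin (d + 1)) :
    arr s (fun x y a b => ∑ κ' : Fin (d + 1), ∑ κ'' : Fin (d + 1), wsum (wd κ') (fun u => wsum (ωd κ'') (S₂ κ' u κ'')) x y a b)
      x z (Sum.inr a) (Sum.inr b) = 0 :=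
  arr_entry_zero s (fun x z => Finset.sum_eq_zero fun κ' _ => Finset.sum_eq_zero fun κ'' _ =>
    wsum_entry_zero _ fun u => wsum_entry_zero _ fun u' => hmm κ' u κ'' u' x z a b) x z

/-- [folklore] **fm = `ε`·TRANSPOSED mf** passes to the array of the slice-summed double superposition. -/
theorem arr_packed₂_inl_inr {ε : ℝ}
    (hfm : ∀ κ u κ' u' x z (a b : Fin (d + 1)), S₂ κ u κ' u' x z (Sum.inl a) (Sum.inr b) = ε * S₂ κ u κ' u' z x (Sum.inr b) (Sum.inl a))
    (x z : Fin (d + 1) → ℤ) (a b : Fin (d + 1)) :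
    arr s (fun x y a b => ∑ κ' : Fin (d + 1), ∑ κ'' : Fin (d + 1), wsum (wd κ') (fun u => wsum (ωd κ'') (S₂ κ' u κ'')) x y a b)
        x z (Sum.inl a) (Sum.inr b)
      = ε * arr s (fun x y a b => ∑ κ' : Fin (d + 1), ∑ κ'' : Fin (d + 1), wsum (wd κ') (fun u => wsum (ωd κ'') (S₂ κ' u κ'')) x y a b)
        z x (Sum.inr b) (Sum.inl a) :=
  arr_entry_rel s (fun x z => by
    rw [Finset.mul_sum]
    refine Finset.sum_congr rfl fun κ' _ => ?_
    rw [Finset.mul_sum]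
    exact Finset.sum_congr rfl fun κ'' _ => wsum_entry_rel _ fun u => wsum_entry_rel _ fun u' => hfm κ' u κ'' u' x z a b) x z

/-- [folklore] **ff `ε`-SYMMETRY** passes to the array of the slice-summed double superposition. -/
theorem arr_packed₂_inl_inl {ε : ℝ}
    (hff : ∀ κ u κ' u' x z (a b : Fin (d + 1)), S₂ κ u κ' u' x z (Sum.inl a) (Sum.inl b) = ε * S₂ κ u κ' u' z x (Sum.inl b) (Sum.inl a))
    (x z : Fin (d + 1) → ℤ) (a b : Fin (d + 1)) :
    arr s (fun x y a b => ∑ κ' : Fin (d + 1), ∑ κ'' : Fin (d + 1), wsum (wd κ') (fun u => wsum (ωd κ'') (S₂ κ' u κ'')) x y a b)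
        x z (Sum.inl a) (Sum.inl b)
      = ε * arr s (fun x y a b => ∑ κ' : Fin (d + 1), ∑ κ'' : Fin (d + 1), wsum (wd κ') (fun u => wsum (ωd κ'') (S₂ κ' u κ'')) x y a b)
        z x (Sum.inl b) (Sum.inl a) :=
  arr_entry_rel s (fun x z => by
    rw [Finset.mul_sum]
    refine Finset.sum_congr rfl fun κ' _ => ?_
    rw [Finset.mul_sum]
    exact Finset.sum_congr rfl fun κ'' _ => wsum_entry_rel _ fun u => wsum_entry_rel _ fun u' => hff κ' u κ'' u' x z a b) x z

end Assembled

end Summit.QuantumFields.BalabanUV.Beta.D1BFx.PackedStructuralSockets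

end
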